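import Literature.AlgebraicGeometry.ShimuraVarieties.UnitaryCurveAuxiliaryTorusLegLift          -- ★ p850805 (LA5-p02): the torus-leg lift read through `(r′ũ)⁻¹`
import Literature.AlgebraicGeometry.ShimuraVarieties.UnitaryCurveAuxiliaryHeckeTransporter     -- ★ `exists_mem_principalLevelSubgroup_eq_of_smul_mk_eq` (the mover՚s `k ∈ K_δ(N)`)
import Literature.AlgebraicGeometry.ModuliOfAbelianVarieties.SiegelAdelicMarkingRationalMove      -- ★ `SiegelAdelicMarking.rationalMove`, `rationalMove_r`, `adelicCongr_rationalMove_iff`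
import Literature.AlgebraicGeometry.ModuliOfAbelianVarieties.SiegelAdelicMarkingPrincipalTransport -- ★ `SiegelAdelicMarking.exists_of_mul_mem_one` (re-indexing along `K_δ(1)`)
import HarnessLib

/-!
# The (B1) tower AT A PRINCIPAL SIEGEL REPRESENTATIVE: `Θ₂`, `IsLambdaOfAt`, and the lift `Λ₂` read through `r₂⁻¹` by the principal marking `m₂` (DEAL #41 letters)

Topic `AlgebraicGeometry/ShimuraVarieties`; namespace `Literature.AlgebraicGeometry.ShimuraVarieties.UnitaryCurve.AuxV`.  THEOREMS ONLY (no definition, no named fact,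
no instance, no notation, no `sorry`).  Cell `hodgecm-mathlib` (D-0151), FLOOR 0, P6 «MOD programme» (crux hLiu418 = stmt-HodgeConjecture-24832, `--supports`,
count-neutral); line «L4», (S8) sheet-line closer `Lines/F0_P6a_StubESHEET.lean`, road (γ′); organ **DEAL #41 «(B1) TOWER» — THE PRINCIPAL LETTERS** (LA4-plan (g2)
2026-09-02 09:11:38Z (b); LA6-p02 (g3) 09:10:58Z: «`Λ₂ : lvl′.SymplecticLift (ℓ_{τE} z₀).left Θ₂ C.δ` with `hΛ₂ : ∀ M, C.N ∣ M → M ≠ 0 → ∀ x v, AdelicCongr ↑r₂⁻¹ 1 v (x∕M) →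
↑(Λ₂.lift M (ofAdd x)) = m₂.r v`» at DEAL #42 §2's principal `(Z₂, r₂ ∈ K_δ(1), m₂, q′ = q_a·q_m)` (LA4-p03 (g3)); consumers (R-CM-3) ★ p850738, (B1) LA7-p01 (g4), #38 LA4-p02 (g2)).

THE MATHEMATICS ([Milne2005ShimuraVarieties] Thm. 6.11 and p. 75: a marking by `[J, a]` IS a marking by `[qJq⁻¹, q·a]`, and `K_δ(1)` re-indexes with the same lattice;
[Deligne1971TravauxShimura] 4.12 (b): `K = GSp(ẑ)` acts on similitude classes; [Shimura1998] §18.6; [Lan2013PELCompactifications] Lemma 1.3.6.5).  INPUT = DEAL #42 §2's package in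
generic tokens: the source fibre `A_{s₀}` marked by `m₀` at the chart's PRINCIPAL representative `rep` with `q_a • [rep]_N = [b_a]_N` (`q_spec`), a witness `Θ` and a lift `Λ`
read by `m₀` through `rep⁻¹`; the target fibre `B_{s₀}` marked by `m₂` at `r₂` with `(q_a q_m) • [r₂]_N = [b_a · ũ_β(1,z)]_N` and the cover reading `m₂.r w = c_{s₀}(m₀.r (q_m w))`;
the torus-leg arithmetic of ★ p850805.  STEPS: `rep = r′k⁻¹` with `r′ := q_a⁻¹ b_a`, `k ∈ K_δ(N)` (★ `exists_mem_principalLevelSubgroup_eq_of_smul_mk_eq`) — re-index `m₀` to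
`m` at `r′ = rep·k` (★ `exists_of_mul_mem_one`): `Λ` is read by `m` through `k·r′⁻¹`; `q_m r₂ = r′ũ k₂⁻¹`, `k₂ ∈ K_δ(N)` (same lemma on `hq′`) — the rational move
`m₂·q_m` (★ `rationalMove`, index `q_m r₂`, `r ↦ m₂.r ∘ q_m⁻¹`, ★ `rationalMove_r`) re-indexed to `r′ũ` is a marking `m_B` with `m_B.r = c_{s₀} ∘ m.r`; ★ p850805 gives
`Θ₂`, `IsLambdaOfAt`, `Λ₂` read through `(r′ũ)⁻¹` by `m_B`; ★ `adelicCongr_rationalMove_iff` rewrites that as «`Λ₂` read by `m₂` through `k₂·r₂⁻¹`», and ★ p850814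
`exists_symplecticLift_of_read_mul_of_mem_principalLevelSubgroup` replaces `Λ₂` by a lift read through `r₂⁻¹` — the letters.

* **`exists_isLambdaOfAt_symplecticLift_torusLeg_principal`** — the head.
Budgets: default heartbeats.  HC_CM is proved only modulo the printed citations (2 remaining named inputs hLiu418 24832, h413 24833) until rung 0 closes — count-neutral.

## References
* [Milne2005ShimuraVarieties] J. S. Milne, *Introduction to Shimura varieties* (2005), §6 Thm. 6.11 pp. 74–75, §12 (63) p. 116.
* [Deligne1971TravauxShimura] P. Deligne, *Travaux de Shimura*, Sém. Bourbaki 389 (1971), 4.12 (b) p. 149, 4.16 p. 150.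
* [Shimura1998] G. Shimura, *Abelian Varieties with Complex Multiplication and Modular Functions* (1998), §18.6 pp. 124–127.
* [Lan2013PELCompactifications] K.-W. Lan, *Arithmetic compactifications of PEL-type Shimura varieties* (2013), §1.3.6 Lemma 1.3.6.5 (p. 81), Cor. 1.3.6.7 (p. 82).
-/

set_option autoImplicit false

noncomputable section

open CategoryTheory AlgebraicGeometry Matrix NumberField IsDedekindDomain MulAction
open scoped nonZeroDivisors Pointwise
open Literature.AlgebraicGeometry.ModuliOfAbelianVarieties
open Literature.AlgebraicGeometry.Motives (AbelianVariety AlgPoints CartierDivisor)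
open Literature.AlgebraicGeometry.AbelianSchemes (AbelianSchemeOver)
open Literature.NumberTheory.Automorphic (integralFiniteAdeles)
open Literature.NumberTheory.Adeles (latticeOfGL)

namespace Literature.AlgebraicGeometry.ShimuraVarieties

namespace UnitaryCurve

namespace AuxV

open Literature.AlgebraicGeometry.ShimuraVarieties.UnitaryCanonicalModel.Aux (ratBasis torusFinAdelic)
open Literature.NumberTheory.Automorphic Literature.NumberTheory.Automorphic.UnitaryGroup
open Literature.NumberTheory.Automorphic.FiniteAdeleRing (toFractionalIdeal)
open Literature.NumberTheory.GaloisRepresentations (modulusExp)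
open Literature.AlgebraicGeometry.AbelianSchemes.AbelianSchemeOver (DualPair)

variable {F : Type} [Field F] [NumberField F] [IsCMField F] {Jstar : Matrix (Fin 2) (Fin 2) F} {ξ : F} {g : ℕ} {δ : Fin g → ℕ}

/-- **(B1)-TOWER AT A PRINCIPAL SIEGEL REPRESENTATIVE — THE LETTERS `Θ₂`, `IsLambdaOfAt`, `Λ₂`, `hΛ₂` THROUGH `r₂⁻¹` BY `m₂`.**  Setting of ★ p850805 (`c : A → B` surjective
over `Y` with `c ≫ λ_B ≫ c^∨ = λ_A ≫ [ν]`, `σ_{B,i} = σ_{A,i} ≫ c`; the torus leg `ũ_β(1,z)` with `[z] = 𝔞⁻¹`, `(ν) = 𝔞·c𝔞`, `z ≡ 1 (mod N)`, `z z̄ = q`).  INPUT (DEAL #42 §2 in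
generic tokens `qa rep ba r₂ qm q′`): the source fibre `A_{s₀}` marked by `m₀` at the chart's principal `rep` with `q_a • [rep]_N = [b_a]_N`, a witness `Θ` of `λ_A` and a
symplectic lift `Λ` read by `m₀` through `rep⁻¹`; the target fibre `B_{s₀}` marked by `m₂` at `r₂` with `q′ = q_a q_m`, `q′ • [r₂]_N = [b_a · ũ_β(1,z)]_N`, and the cover
reading `m₂.r w = c_{s₀}(m₀.r (q_m w))`.  OUTPUT: an AMPLE witness `Θ₂` of `λ_B` at `s₀` with `IsLambdaOfAt`, and `Λ₂ : σ_B.SymplecticLift s₀ Θ₂ δ` whose tower is read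
through `r₂⁻¹` by `m₂`: `r₂⁻¹ v̂ ≡ x̃∕M ⟹ Λ₂,M(x) = u₂(v)`. [cite: Milne2005ShimuraVarieties, §6 Thm. 6.11 pp. 74–75 and §12 (63) p. 116]
[cite: Deligne1971TravauxShimura, 4.12 (b) p. 149 and 4.16 p. 150] [cite: Shimura1998, §18.6 pp. 124–127] [cite: Lan2013PELCompactifications, §1.3.6 Lemma 1.3.6.5 (p. 81) and Cor. 1.3.6.7 (p. 82)] -/
theorem exists_isLambdaOfAt_symplecticLift_torusLeg_principal (hδ : IsPolarizationType δ) (hg : 0 < g)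
    (Fr : SymplecticFrameV F (RingHom.id F) Jstar ξ g δ)
    (ρ : 𝓞 F →+* Matrix (Fin g ⊕ Fin g) (Fin g ⊕ Fin g) ℤ)
    (hρ : ∀ b : 𝓞 F, (ρ b).map (Int.cast : ℤ → ℚ) =
      framePV Fr * resMatrix (m := Fin 2) (ratBasis F) (((b : 𝓞 F) : F) • (1 : Matrix (Fin 2) (Fin 2) F)) * frameQV Fr)
    -- the sheet arithmetic: `[z] = 𝔞⁻¹`, `(ν) = 𝔞 · c𝔞`, `z ≡ 1 (mod N)`, `z z̄ = q`
    (z : ↥(torusFinAdelic F)) (𝔞 : Ideal (𝓞 F)) (h𝔞 : 𝔞 ≠ ⊥)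
    (hz : toFractionalIdeal (𝓞 F) F (z : (FiniteAdeleRing (𝓞 F) F)ˣ) = ((𝔞 : FractionalIdeal (𝓞 F)⁰ F))⁻¹)
    {ν : ℕ} (hν : ν ≠ 0) (hνa : Ideal.span {((ν : ℕ) : 𝓞 F)} = 𝔞 * (IsCMField.complexConj F) • 𝔞)
    {N : ℕ} (hN : N ≠ 0)
    (hcong : ∀ v : HeightOneSpectrum (𝓞 F), Ideal.span {((N : ℕ) : 𝓞 F)} ≤ v.asIdeal →
      Valued.v (((z : (FiniteAdeleRing (𝓞 F) F)ˣ) : FiniteAdeleRing (𝓞 F) F) v) = 1 ∧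
        Valued.v (((z : (FiniteAdeleRing (𝓞 F) F)ˣ) : FiniteAdeleRing (𝓞 F) F) v - 1) ≤ WithZero.exp (-(modulusExp (Ideal.span {((N : ℕ) : 𝓞 F)}) v : ℤ)))
    (q : finAdeleQˣ)
    (hq : ((z : (FiniteAdeleRing (𝓞 F) F)ˣ) : FiniteAdeleRing (𝓞 F) F) *
        conjFiniteAdele (↥(maximalRealSubfield F)) F (IsCMField.complexConj F) ((z : (FiniteAdeleRing (𝓞 F) F)ˣ) : FiniteAdeleRing (𝓞 F) F) =
      FiniteAdeleRing.baseChange (𝓞 ℚ) ℚ F (𝓞 F) (q : finAdeleQ))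
    -- the cover and its global rows (t3), (t5)
    {Y : Scheme.{0}} {A B : AbelianSchemeOver Y} [IsCommMonObj A.X] [IsCommMonObj B.X] (c : A.X ⟶ B.X) [IsMonHom c] [Surjective c.left]
    (φ : A.LevelStructure g N) (φ' : B.LevelStructure g N) (hφ' : ∀ i, φ'.σ i = φ.σ i ≫ c)
    {D : A.DualPair} {D' : B.DualPair} (pol : A.Polarization D) (pol' : B.Polarization D')
    (ht3 : c ≫ pol'.lam ≫ DualPair.dualIsogenyOver c D D' = pol.lam ≫ D.hat.mulN ν)
    -- the marked source fibre at the chart's principal representative `rep`, `q_a • [rep] = [b_a]` (DEAL #42 §2 ∕ `q_spec`)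
    {s₀ : Spec (.of ℂ) ⟶ Y} {J J₂ : C0pm δ} {rep ba : ↥(gspFinAdelic δ)} {qa : ↥(gspRational δ)}
    (hq_spec : gspRationalToFinAdelic δ qa • ((rep : ↥(gspFinAdelic δ)) : ↥(gspFinAdelic δ) ⧸ principalLevelSubgroup δ N) =
      ((ba : ↥(gspFinAdelic δ)) : ↥(gspFinAdelic δ) ⧸ principalLevelSubgroup δ N))
    (Θ : CartierDivisor (A.fibre s₀).toAbelianVariety.X.left) (hΘ : A.IsLambdaOfAt s₀ D pol.lam Θ) (Λ : φ.SymplecticLift s₀ Θ δ)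
    (m₀ : SiegelAdelicMarking J rep (A.fibre s₀).toAbelianVariety)
    (hread₀ : ∀ ⦃M : ℕ⦄, N ∣ M → M ≠ 0 → ∀ (x : Fin g ⊕ Fin g → ZMod M) (v : Fin g ⊕ Fin g → ℚ),
      AdelicCongr ((rep⁻¹ : ↥(gspFinAdelic δ)) : GL (Fin g ⊕ Fin g) finAdeleQ) 1 v (fun i => ((x i).val : ℚ) / M) →
        ((Λ.lift M (Multiplicative.ofAdd x)) : (A.fibre s₀).toAbelianVariety.Points ℂ) = m₀.r v)
    -- the marked twisted fibre at a principal representative moved by `q_m` (DEAL #42 §2)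
    {r₂ : ↥(gspFinAdelic δ)} (qm q' : ↥(gspRational δ)) (hq'eq : q' = qa * qm)
    (m₂ : SiegelAdelicMarking J₂ r₂ (B.fibre s₀).toAbelianVariety)
    (hq' : gspRationalToFinAdelic δ q' • ((r₂ : ↥(gspFinAdelic δ)) : ↥(gspFinAdelic δ) ⧸ principalLevelSubgroup δ N) =
      ((ba * auxToGspFinV Fr (1, z) : ↥(gspFinAdelic δ)) : ↥(gspFinAdelic δ) ⧸ principalLevelSubgroup δ N))
    (hm₂ : ∀ w, m₂.r w = AlgPoints.map (AbelianSchemeOver.fibreHom c s₀).hom.hom.hom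
      (m₀.r ((((qm : ↥(gspRational δ)) : GL (Fin g ⊕ Fin g) ℚ) : Matrix (Fin g ⊕ Fin g) (Fin g ⊕ Fin g) ℚ) *ᵥ w))) :
    ∃ Θ₂ : CartierDivisor (B.fibre s₀).toAbelianVariety.X.left, Θ₂.IsAmple ∧ B.IsLambdaOfAt s₀ D' pol'.lam Θ₂ ∧
      ∃ Λ₂ : φ'.SymplecticLift s₀ Θ₂ δ,
        ∀ ⦃M : ℕ⦄, N ∣ M → M ≠ 0 → ∀ (x : Fin g ⊕ Fin g → ZMod M) (v : Fin g ⊕ Fin g → ℚ),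
          AdelicCongr ((r₂⁻¹ : ↥(gspFinAdelic δ)) : GL (Fin g ⊕ Fin g) finAdeleQ) 1 v (fun i => ((x i).val : ℚ) / M) →
            ((Λ₂.lift M (Multiplicative.ofAdd x)) : (B.fibre s₀).toAbelianVariety.Points ℂ) = m₂.r v := by
  subst hq'eq
  -- the chart mover's `k`: `rep = r′ · k⁻¹`, `r′ := q_a⁻¹ b_a`, `k ∈ K_δ(N)`
  obtain ⟨k, hk, hrepk⟩ := exists_mem_principalLevelSubgroup_eq_of_smul_mk_eq N rep ba qa hq_spec
  have hk1 : k ∈ principalLevelSubgroup δ 1 := principalLevelSubgroup_anti δ (one_dvd N) hk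
  -- the twisted mover's `k₂`: `r₂ = (q_a q_m)⁻¹ (b_a ũ) k₂⁻¹`, `k₂ ∈ K_δ(N)`
  obtain ⟨k₂, hk₂, hr₂k⟩ := exists_mem_principalLevelSubgroup_eq_of_smul_mk_eq N r₂ (ba * auxToGspFinV Fr (1, z)) (qa * qm) hq'
  have hk₂1 : k₂ ∈ principalLevelSubgroup δ 1 := principalLevelSubgroup_anti δ (one_dvd N) hk₂
  -- the two index identities
  have hidx : gspRationalToFinAdelic δ qm * r₂ * k₂ = rep * k * auxToGspFinV Fr (1, z) := by
    rw [hr₂k, hrepk, map_mul]; group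
  have hkr : k * (rep * k)⁻¹ = rep⁻¹ := by group
  -- re-index `m₀` to `m` at `r′ = rep · k` (same `r`)
  obtain ⟨m, -, -, -, hmr⟩ := m₀.exists_of_mul_mem_one hk1
  -- the target marking `m_B` at `r′ũ`: the rational move `m₂·q_m` re-indexed along `k₂`
  obtain ⟨mB, hmB⟩ : ∃ mB : SiegelAdelicMarking (conjAct δ (gspRationalToReal δ qm) J₂) (rep * k * auxToGspFinV Fr (1, z)) (B.fibre s₀).toAbelianVariety,
      ∀ w, mB.r w = m₂.r (((((qm : ↥(gspRational δ)) : GL (Fin g ⊕ Fin g) ℚ)⁻¹ : GL (Fin g ⊕ Fin g) ℚ) :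
        Matrix (Fin g ⊕ Fin g) (Fin g ⊕ Fin g) ℚ) *ᵥ w) := by
    rw [← hidx]
    obtain ⟨n, -, -, -, hn⟩ := (m₂.rationalMove qm).exists_of_mul_mem_one hk₂1
    exact ⟨n, fun w => (hn w).trans (m₂.rationalMove_r qm w)⟩
  -- `m_B` reads the cover as `id` on `V`: `m_B.r = c_{s₀} ∘ m.r`
  have hqq : ∀ w : Fin g ⊕ Fin g → ℚ,
      (((qm : ↥(gspRational δ)) : GL (Fin g ⊕ Fin g) ℚ) : Matrix (Fin g ⊕ Fin g) (Fin g ⊕ Fin g) ℚ) *ᵥ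
        (((((qm : ↥(gspRational δ)) : GL (Fin g ⊕ Fin g) ℚ)⁻¹ : GL (Fin g ⊕ Fin g) ℚ) : Matrix (Fin g ⊕ Fin g) (Fin g ⊕ Fin g) ℚ) *ᵥ w) = w :=
    fun w => by rw [Matrix.mulVec_mulVec, ← Units.val_mul, mul_inv_cancel, Units.val_one, Matrix.one_mulVec]
  have hmB' : ∀ w, mB.r w = AlgPoints.map (AbelianSchemeOver.fibreHom c s₀).hom.hom.hom (m.r w) := fun w => by
    rw [hmB, hm₂, hqq, hmr]
  -- `Λ` is read by `m` through `k · r′⁻¹ = rep⁻¹`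
  have hread : ∀ ⦃M : ℕ⦄, N ∣ M → M ≠ 0 → ∀ (x : Fin g ⊕ Fin g → ZMod M) (v : Fin g ⊕ Fin g → ℚ),
      AdelicCongr ((k * (rep * k)⁻¹ : ↥(gspFinAdelic δ)) : GL (Fin g ⊕ Fin g) finAdeleQ) 1 v (fun i => ((x i).val : ℚ) / M) →
        ((Λ.lift M (Multiplicative.ofAdd x)) : (A.fibre s₀).toAbelianVariety.Points ℂ) = m.r v := by
    intro M hM hM0 x v hv
    rw [hkr] at hv
    rw [hmr]
    exact hread₀ hM hM0 x v hv
  -- ★ p850805 at the torus leg: `Θ₂`, `IsLambdaOfAt`, `Λ₂` read through `(r′ũ)⁻¹` by `m_B`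
  obtain ⟨Θ₂, hamp, hΘ₂, Λ₂, hΛ₂⟩ := exists_isLambdaOfAt_symplecticLift_torusLeg hδ hg Fr ρ hρ z 𝔞 h𝔞 hz hν hνa hN hcong q hq c φ φ' hφ'
    pol pol' ht3 hk Θ hΘ Λ m hread mB hmB'
  refine ⟨Θ₂, hamp, hΘ₂, ?_⟩
  -- `Λ₂` is read by `m₂` through `k₂⁻¹ · r₂⁻¹` (`r′ũ = q_m · r₂ · k₂`, ★ `adelicCongr_rationalMove_iff`)
  have hidx' : rep * k * auxToGspFinV Fr (1, z) = gspRationalToFinAdelic δ qm * (r₂ * k₂) := by rw [← hidx, mul_assoc]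
  have hread₂ : ∀ ⦃M : ℕ⦄, N ∣ M → M ≠ 0 → ∀ (x : Fin g ⊕ Fin g → ZMod M) (v : Fin g ⊕ Fin g → ℚ),
      AdelicCongr ((k₂⁻¹ * r₂⁻¹ : ↥(gspFinAdelic δ)) : GL (Fin g ⊕ Fin g) finAdeleQ) 1 v (fun i => ((x i).val : ℚ) / M) →
        ((Λ₂.lift M (Multiplicative.ofAdd x)) : (B.fibre s₀).toAbelianVariety.Points ℂ) = m₂.r v := by
    intro M hM hM0 x v hv
    have hv' : AdelicCongr (((rep * k * auxToGspFinV Fr (1, z))⁻¹ : ↥(gspFinAdelic δ)) : GL (Fin g ⊕ Fin g) finAdeleQ) 1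
        ((((qm : ↥(gspRational δ)) : GL (Fin g ⊕ Fin g) ℚ) : Matrix (Fin g ⊕ Fin g) (Fin g ⊕ Fin g) ℚ) *ᵥ v) (fun i => ((x i).val : ℚ) / M) := by
      rw [hidx', SiegelAdelicMarking.adelicCongr_rationalMove_iff, _root_.mul_inv_rev]
      rw [Matrix.mulVec_mulVec, ← Units.val_mul, inv_mul_cancel, Units.val_one, Matrix.one_mulVec]
      exact hv
    rw [hΛ₂ hM hM0 x _ hv', hmB, Matrix.mulVec_mulVec, ← Units.val_mul, inv_mul_cancel, Units.val_one, Matrix.one_mulVec]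
  -- ★ p850814: replace `Λ₂` by a lift read through `r₂⁻¹`
  exact SiegelAdelicMarking.exists_symplecticLift_of_read_mul_of_mem_principalLevelSubgroup hδ hg hN (inv_mem hk₂) φ' Θ₂ Λ₂ m₂ hread₂

end AuxV

end UnitaryCurve

end Literature.AlgebraicGeometry.ShimuraVarieties

end
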